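import Summits.ABC.StewartYu.PadicG3TwoThirdReindex
import Summits.ABC.StewartYu.PadicG3TwoThirdSizes
import Summits.ABC.StewartYu.PadicG3TwoThirdSmall
import Summits.ABC.StewartYu.PadicG3TwoSlabReindex
import HarnessLib

/-!
# Cell abc-stewartyu, Gen-3 frame at `p = 2` (crux `Y07Two`, stmt-ABC-19659), layer F5 brick (7): the THIRD STEP
# PACKAGED — `ThirdStepTwo σ Sh I` of the level induction from one record inequality, the `3`-Kummer condition,
# and the assembler's basis step

`Summits/ABC/StewartYu/PadicG3TwoThirdStep.lean` — cell `abc-stewartyu` (HOME `run/shared/lean/pub/abc-stewartyu/`),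
route `PadicPrimesKummerThird`, seat p5 (g3) (F5 bricks (5)–(7) of the F-two lead's memo-09 §13).  Two `ℕ`/`ℝ`-valued
definitions (`thirdDen`, `thirdM`: the denominator and size of the class vector in the schedule's letters), two
`Prop`-structures (`ThirdFinalTwo σ I`: the record's obligations; `BasisStepTwo σ Sh I`: the assembler's), and
theorems on `TwoSetup`; no named fact.

THE STEP `I → I + 1` (Yu 2013 Lemmas 5.3–5.4; Nesterenko 2003 §4.3).  Given an admissible family `Λ` at level `I`
(`G3Adm σ Sh I Λ`) whose values vanish at all integers `|x| ≤ Nfin I` for `|τ| < Tfin I`: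
1. SMALLNESS at the third points `s/3` + multicubic LIOUVILLE (p3-g5's `PadicG3TwoThirdSmall.thirdVec_eq_zero_of_zeros`,
   with the `3`-Kummer condition on `(α, θ)`), fed with the denominators/sizes of `PadicG3TwoThirdSizes` — where the
   `Y₀`-weight data AT THE THIRD POINT is read off the NEXT level's data for the rescaled basis `Rᵢ ∘ (Y₀/3)`
   (`eval_hasseDeriv_comp_third`: `(Hasse_t R)(s/3) = 3ᵗ·(Hasse_t (R∘(Y₀/3)))(s)`) — and ONE record inequality
   (`ThirdFinalTwo.hfinal`) ⇒ every triadic class sum vanishes at `|s| ≤ N0 (I+1)`, `3 ∤ s`, `|τ| < T0 (I+1)`;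
2. RE-INDEXING (`PadicG3TwoThirdReindex.vanish_cop_reindex3`) on the class `v` of an unknown `i₁` with `pᵢ₁ ≠ 0`:
   the family `Λ.reindex3 v i₁` vanishes at those coprime nodes;
3. ADMISSIBILITY at level `I + 1` of the re-indexed family: size/coefficients/degrees/fibres inherited, box
   `|κ′| ≤ (|κ|+2)/3` (`ThirdFinalTwo.Dbox_succ/Dθ_succ`), directional bound from the new box (`Xb_succ`), the slab
   RE-BASED at `i₁` (`‖3⁻¹‖₂ = 1`, ultrametric), the weighted coefficient bound TRANSPORTED
   (`norm_coeff_hw_comp_third`: `‖coeffₖ Hasse_t (R∘(Y₀/3))‖₂ = ‖coeffₖ Hasse_t R‖₂`, with `Bw I ≤ Bw (I+1)`), and the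
   `Y₀`-weight integrality at the integers + the shape predicate from `BasisStepTwo` (the assembler knows the basis:
   `Rᵢ = Δ(3^{I*−I}Y₀; ℓᵢ, H)`, Nesterenko's pre-scaling, so every level has integer arguments).
Result: **`thirdStepTwo_of`**.

WHAT THIS IS NOT: no choice of numbers (record), no basis facts (assembler, `PadicG3TwoFeldmanBasis`); no crux moves.

References: K. Yu, Acta Math. 211 (2013), Lemmas 5.3–5.4, (5.1), (5.44)–(5.57); Yu. V. Nesterenko, LNM 1819
(2003), §4.3; K. Yu, Compositio Math. 74 (1990), §3.
-/

noncomputable section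

open Finset Polynomial
open Literature.NumberTheory.Transcendental
open Literature.NumberTheory.Transcendental.CW77 (heightProd)
open Literature.NumberTheory.Transcendental.CW77.Setup (Tau tauNorm)
open Literature.NumberTheory.Transcendental.PadicCW77 (condExp)

namespace Summit.ABC.StewartYu

namespace TwoSetup

/-! ### Coefficients of a linearly rescaled polynomial (the weighted bound transports) -/

/-- `coeffₖ (g ∘ (c·Y)) = cᵏ · coeffₖ g`. [folklore] -/
theorem coeff_comp_C_mul_X {K : Type*} [Field K] (g : K[X]) (c : K) (k : ℕ) :
    (g.comp (C c * X)).coeff k = c ^ k * g.coeff k := by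
  induction g using Polynomial.induction_on' with
  | add p q hp hq => rw [Polynomial.add_comp, coeff_add, coeff_add, hp, hq, mul_add]
  | monomial n a =>
    rw [Polynomial.monomial_comp, mul_pow, ← C_pow, ← mul_assoc, ← map_mul, Polynomial.coeff_C_mul_X_pow,
      Polynomial.coeff_monomial]
    by_cases h : n = k
    · subst h; simp [mul_comm]
    · rw [if_neg (Ne.symm h), if_neg h, mul_zero]

/-- `coeffₖ Hasse_t (f ∘ (c·Y)) = c^{t+k} · coeffₖ Hasse_t f`. [folklore] -/
theorem coeff_hasseDeriv_comp_C_mul_X {K : Type*} [Field K] (f : K[X]) (c : K) (t k : ℕ) :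
    (hasseDeriv t (f.comp (C c * X))).coeff k = c ^ (t + k) * (hasseDeriv t f).coeff k := by
  rw [hasseDeriv_comp_C_mul_X, coeff_C_mul, coeff_comp_C_mul_X, pow_add, mul_assoc]

variable (S : TwoSetup) {ι : Type*}

/-- **The `2`-adic weighted coefficient bound transports to the rescaled basis**:
`‖coeffₖ (hw (R ∘ (Y₀/3)) i t₀)‖₂ = ‖coeffₖ (hw R i t₀)‖₂` (`3` is a `2`-adic unit). [folklore] -/
theorem norm_coeff_hw_comp_third (R : ι → ℚ[X]) (i : ι) (t₀ k : ℕ) :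
    ‖(hw (fun i => (R i).comp (C (3⁻¹ : ℚ) * X)) i t₀).coeff k‖ = ‖(hw R i t₀).coeff k‖ := by
  unfold hw
  rw [Polynomial.coeff_map, Polynomial.coeff_map, coeff_hasseDeriv_comp_C_mul_X, map_mul, norm_mul,
    map_pow, norm_pow, eq_ratCast, eq_ratCast]
  have h3 : ‖((3⁻¹ : ℚ) : ℚ_[2])‖ = 1 := by
    rw [Rat.cast_inv, norm_inv]
    have : ((3 : ℚ) : ℚ_[2]) = (3 : ℚ_[2]) := by norm_cast
    rw [this, norm_three_two, inv_one]
  rw [h3, one_pow, one_mul]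

/-! ### The record's and the assembler's obligations for the step `I → I + 1` -/

variable {S} (σ : S.G3TwoSched) (Sh : ℕ → S.G3Fam ι → Prop)

/-- **The denominator of the class vector at `(s, τ)` in the schedule's letters**:
`den₀(I+1)(s,τ)·|b_θ|^{|t|}·monDen(all, thirdBox (Dbox I) (Dθ I) s)`. [cite: Yu2013, (5.35); shape only] -/
def thirdDen (I : ℕ) (s : ℤ) (τ : Tau S.d) : ℕ :=
  σ.den₀ (I + 1) s τ * S.bθ.natAbs ^ (∑ j, τ.2 j) *
    MonomialDen.monDen S.toQ.all (S.thirdBox (σ.Dbox I) (σ.Dθ I) s)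

/-- **The size of the class vector at `(s, τ)` in the schedule's letters**:
`max 1 (cardB I·P·(3^{t₀}·M₀(I+1)(s,τ)·Xb I^{|t|}·monDen(all, thirdBox s)²))`. [cite: Yu2013, (5.38); shape only] -/
def thirdM (I : ℕ) (s : ℤ) (τ : Tau S.d) : ℝ :=
  max 1 ((σ.cardB I : ℝ) * σ.P * ((3 : ℝ) ^ τ.1 * σ.M₀ (I + 1) s τ * (σ.Xb I : ℝ) ^ (∑ j, τ.2 j) *
    ((MonomialDen.monDen S.toQ.all (S.thirdBox (σ.Dbox I) (σ.Dθ I) s) : ℝ)) ^ 2))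

/-- **THE RECORD'S OBLIGATIONS FOR THE THIRD STEP `I → I + 1`**: a positive order decrement fitting between
`T0 (I+1)` and `Tfin I`, monotone slots (`cardB`, `Bw`), the new box and directional bound, positive denominators,
and the Liouville threshold inequality at every new node. [cite: Yu2013, Lemma 5.4 (5.58)–(5.70); shape only] -/
structure ThirdFinalTwo (I : ℕ) : Prop where
  /-- the multiplicity spent at the third points -/
  tthird_pos : 1 ≤ σ.Tfin I - σ.T0 (I + 1)
  /-- order budget -/
  T0_succ_le : σ.T0 (I + 1) ≤ σ.Tfin I
  /-- family size slot is monotone -/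
  cardB_mono : σ.cardB I ≤ σ.cardB (I + 1)
  /-- weighted coefficient slot is monotone -/
  Bw_mono : σ.Bw I ≤ σ.Bw (I + 1)
  /-- the new box in the free generators -/
  Dbox_succ : ∀ j, (σ.Dbox I j + 2) / 3 ≤ σ.Dbox (I + 1) j
  /-- the new box in `θ` -/
  Dθ_succ : (σ.Dθ I + 2) / 3 ≤ σ.Dθ (I + 1)
  /-- the new directional bound -/
  Xb_succ : ∀ j, |S.bθ| * (σ.Dbox (I + 1) j : ℤ) + |S.b j| * (σ.Dθ (I + 1) : ℤ) ≤ σ.Xb (I + 1)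
  /-- positive `Y₀`-weight denominators at the next level -/
  one_le_den₀ : ∀ (x : ℤ) (τ : Tau S.d), 1 ≤ σ.den₀ (I + 1) x τ
  /-- the third-step inequality at every new node -/
  hfinal : ∀ s : ℤ, |s| ≤ (σ.N0 (I + 1) : ℤ) → ¬ (3 : ℤ) ∣ s → ∀ τ : Tau S.d, tauNorm τ < σ.T0 (I + 1) →
    max (σ.Bw I * ‖S.Λ₀‖ * (2 : ℝ) ^ (σ.Tfin I - σ.T0 (I + 1)) *
          (2 : ℝ) ^ condExp 2 (2 * σ.Nfin I + 1) (σ.Tfin I - σ.T0 (I + 1)))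
        (σ.Bw I / (4 * (2 : ℝ) ^ σ.m) ^ ((2 * σ.Nfin I + 1) * (σ.Tfin I - σ.T0 (I + 1)))) <
      1 / (6 * (thirdDen σ I s τ : ℝ) * thirdM σ I s τ * heightProd S.toQ.all ^ 5) ^ (3 ^ (S.d + 1 + 1) - 1)

/-- **THE ASSEMBLER'S BASIS STEP `I → I + 1`**: for every admissible family at level `I`, the rescaled basis
`Rᵢ ∘ (Y₀/3)` has the pointwise `Y₀`-weight integrality data of level `I + 1` at the integers (Nesterenko's
pre-scaled Fel'dman basis: integer arguments at every level), and the shape predicate holds for every re-indexed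
class containing its base point. [cite: Nesterenko2003, §3.1 and (4.20); shape only] -/
structure BasisStepTwo (I : ℕ) : Prop where
  /-- `Y₀`-weights of the rescaled basis at the integers -/
  hasse : ∀ Λ : S.G3Fam ι, S.G3Adm σ Sh I Λ → ∀ i ∈ Λ.B, ∀ (x : ℤ) (τ : Tau S.d), ∃ z₀ : ℤ,
    (σ.den₀ (I + 1) x τ : ℚ) * (hasseDeriv τ.1 ((Λ.R i).comp (C (3⁻¹ : ℚ) * X))).eval (x : ℚ) = z₀ ∧
      |z₀| ≤ σ.M₀ (I + 1) x τ
  /-- the shape predicate passes to every re-indexed class -/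
  shape : ∀ Λ : S.G3Fam ι, S.G3Adm σ Sh I Λ → ∀ (v : Fin (S.d + 1) → Fin 3) (i₁ : ι),
    i₁ ∈ (Λ.reindex3 v i₁).B → Sh (I + 1) (Λ.reindex3 v i₁)

/-! ### The class sums vanish at the new nodes -/

/-- **All triadic class sums vanish** at `|s| ≤ N0 (I+1)`, `3 ∤ s`, `|τ| < T0 (I+1)`, for an admissible level-`I`
family vanishing at all `|x| ≤ Nfin I`, `|τ| < Tfin I`. [cite: Yu2013, Lemmas 5.3–5.4] -/
theorem thirdVec_eq_zero_of_adm {I : ℕ} (hfin : ThirdFinalTwo σ I) (hbs : BasisStepTwo σ Sh I)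
    (hK : ∀ κ : Fin (S.d + 1) → ℕ, (∃ j, ¬ 3 ∣ κ j) → ∀ γ : ℚ, ∏ j, S.toQ.all j ^ κ j ≠ γ ^ 3)
    {Λ : S.G3Fam ι} (hadm : S.G3Adm σ Sh I Λ) (hvan : Λ.vanish nodesAll (σ.Nfin I) (σ.Tfin I)) :
    ∀ s : ℤ, |s| ≤ (σ.N0 (I + 1) : ℤ) → ¬ (3 : ℤ) ∣ s → ∀ τ : Tau S.d, tauNorm τ < σ.T0 (I + 1) →
      S.thirdVec Λ.R Λ.u Λ.uθ Λ.B Λ.p τ s = 0 := by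
  intro s hs h3 τ hτ
  obtain ⟨i, hi, _⟩ := hadm.exists_ne
  have hBw0 : 0 ≤ σ.Bw I := by
    have h := hadm.wt i hi 0 0
    rw [pow_zero, mul_one] at h
    exact (norm_nonneg _).trans h
  -- third-point weight data from the next level's data for `R ∘ (Y₀/3)`
  have hR3 : ∀ i ∈ Λ.B, ∃ z₀ : ℤ, (σ.den₀ (I + 1) s τ : ℚ) * (hasseDeriv τ.1 (Λ.R i)).eval ((s : ℚ) / 3) = z₀ ∧
      |z₀| ≤ 3 ^ τ.1 * σ.M₀ (I + 1) s τ := by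
    intro i hi
    obtain ⟨z₀, hz₀, hle⟩ := hbs.hasse Λ hadm i hi s τ
    refine ⟨3 ^ τ.1 * z₀, ?_, ?_⟩
    · rw [eval_hasseDeriv_comp_third, ← mul_assoc, mul_comm (σ.den₀ (I + 1) s τ : ℚ), mul_assoc, hz₀]
      push_cast; ring
    · rw [abs_mul, abs_pow, abs_of_pos (by norm_num : (0 : ℤ) < 3)]
      exact mul_le_mul_of_nonneg_left hle (pow_nonneg (by norm_num) _)
  have hD : 1 ≤ thirdDen σ I s τ := by
    unfold thirdDen
    exact one_le_mul (one_le_mul (hfin.one_le_den₀ s τ) (Nat.one_le_pow _ _ (Int.natAbs_pos.mpr S.bθ_ne)))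
      (MonomialDen.one_le_monDen _ S.toQ.all_ne _)
  have hden : ∀ r, ∃ z : ℤ, (thirdDen σ I s τ : ℚ) * S.thirdVec Λ.R Λ.u Λ.uθ Λ.B Λ.p τ s r = z := by
    intro r
    obtain ⟨z, hz, _⟩ := S.exists_int_clear_mul_thirdVec Λ.R Λ.u Λ.uθ Λ.B Λ.p hadm.u_le hadm.uθ_le τ s hR3
      hadm.dir_le hadm.p_le r
    exact ⟨z, hz⟩
  have hM : 1 ≤ thirdM σ I s τ := le_max_left _ _
  have hcM : ∑ r, |(S.thirdVec Λ.R Λ.u Λ.uθ Λ.B Λ.p τ s r : ℝ)| ≤ thirdM σ I s τ := by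
    refine (S.sum_abs_thirdVec_le Λ.R Λ.u Λ.uθ Λ.B Λ.p hadm.u_le hadm.uθ_le τ s (hfin.one_le_den₀ s τ)
      hR3 hadm.dir_le hadm.p_le).trans (le_trans ?_ (le_max_right _ _))
    have hcard : (Λ.B.card : ℝ) ≤ σ.cardB I := by exact_mod_cast hadm.card_le
    have hP0 : (0 : ℝ) ≤ σ.P := by exact_mod_cast (abs_nonneg _).trans (hadm.p_le i hi)
    have hM0 : (0 : ℝ) ≤ σ.M₀ (I + 1) s τ := by
      obtain ⟨z₀, _, hle⟩ := hbs.hasse Λ hadm i hi s τ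
      exact_mod_cast (abs_nonneg _).trans hle
    have hXb : (0 : ℝ) ≤ (σ.Xb I : ℝ) ^ (∑ j, τ.2 j) := by
      rcases Nat.eq_zero_or_pos (∑ j, τ.2 j) with h0 | hpos
      · rw [h0, pow_zero]; exact zero_le_one
      · obtain ⟨j, -, hj⟩ := Finset.exists_ne_zero_of_sum_ne_zero (by omega : ∑ j, τ.2 j ≠ 0)
        have : (0 : ℤ) ≤ σ.Xb I := (abs_nonneg _).trans (hadm.dir_le i hi j)
        exact pow_nonneg (by exact_mod_cast this) _
    have hbr : (0 : ℝ) ≤ (3 : ℝ) ^ τ.1 * σ.M₀ (I + 1) s τ * (σ.Xb I : ℝ) ^ (∑ j, τ.2 j) *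
        ((MonomialDen.monDen S.toQ.all (S.thirdBox (σ.Dbox I) (σ.Dθ I) s) : ℝ)) ^ 2 := by positivity
    have key := mul_le_mul_of_nonneg_right (mul_le_mul_of_nonneg_right hcard hP0) hbr
    push_cast at key ⊢
    linarith [key]
  have hzero : ∀ x : ℤ, |x| ≤ (σ.Nfin I : ℤ) → ∀ τ'' : Tau S.d, tauNorm τ'' < σ.Tfin I →
      S.g3φ Λ.R Λ.u Λ.uθ Λ.B Λ.p τ'' x = 0 := fun x hx τ'' hτ'' => hvan x hx trivial τ'' hτ''
  have hT0 := hfin.T0_succ_le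
  have hτ' : tauNorm τ + (σ.Tfin I - σ.T0 (I + 1)) ≤ σ.Tfin I := by omega
  exact S.thirdVec_eq_zero_of_zeros Λ.R Λ.u Λ.uθ hK Λ.B Λ.p Λ.i₀ hadm.slab hfin.tthird_pos hBw0 hadm.wt
    hzero s τ hτ' hD hden hM hcM (hfin.hfinal s hs h3 τ hτ)

/-! ### Admissibility of the re-indexed family -/

/-- `|b| ≤ (D + 2)/3` when `a = 3b + v̂`, `|a| ≤ D`, `0 ≤ v̂ ≤ 2`. [folklore] -/
theorem abs_le_of_eq_three_mul_add {a b D w : ℤ} (h : a = 3 * b + w) (ha : |a| ≤ D) (hw0 : 0 ≤ w)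
    (hw2 : w ≤ 2) : |b| ≤ (D + 2) / 3 := by
  rw [abs_le] at ha ⊢
  constructor <;> omega

/-- **The re-indexed class of an unknown with a nonzero coefficient is admissible at level `I + 1`.**
[cite: Yu2013, Lemma 5.4 and (5.1); shape only] -/
theorem adm_reindex3 {I : ℕ} (hfin : ThirdFinalTwo σ I) (hbs : BasisStepTwo σ Sh I)
    {Λ : S.G3Fam ι} (hadm : S.G3Adm σ Sh I Λ) {i₁ : ι} (hi₁ : i₁ ∈ Λ.B) (hp₁ : Λ.p i₁ ≠ 0) :
    S.G3Adm σ Sh (I + 1) (Λ.reindex3 (S.res3 (Fin.snoc (Λ.u i₁) (Λ.uθ i₁)) 1) i₁) := by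
  set v := S.res3 (Fin.snoc (Λ.u i₁) (Λ.uθ i₁)) 1 with hv
  set Λ' := Λ.reindex3 v i₁ with hΛ'
  have hsub : ∀ i ∈ Λ'.B, i ∈ Λ.B := fun i hi => Λ.reindex3_B_subset v i₁ hi
  have hi₁' : i₁ ∈ Λ'.B := (Λ.mem_reindex3_B v i₁).mpr ⟨hi₁, rfl⟩
  have hrepr0 : ∀ k, 0 ≤ S.repr3 v k := fun k => by unfold repr3; positivity
  have hrepr2 : ∀ k, S.repr3 v k ≤ 2 := fun k => by unfold repr3; have := (v k).isLt; omega
  have hq1 : (C (3⁻¹ : ℚ) * X).natDegree = 1 := natDegree_C_mul_X _ (by norm_num)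
  have hdeg : ∀ i, (Λ'.R i).natDegree = (Λ.R i).natDegree := by
    intro i
    change ((Λ.R i).comp (C (3⁻¹ : ℚ) * X)).natDegree = _
    rw [natDegree_comp, hq1, mul_one]
  -- the new box
  have hu' : ∀ i ∈ Λ'.B, ∀ j, |Λ'.u i j| ≤ (σ.Dbox (I + 1) j : ℤ) := by
    intro i hi j
    refine (abs_le_of_eq_three_mul_add (Λ.u_eq_of_mem v i₁ hi j) (hadm.u_le i (hsub i hi) j)
      (hrepr0 _) (hrepr2 _)).trans ?_
    have := hfin.Dbox_succ j
    omega
  have huθ' : ∀ i ∈ Λ'.B, |Λ'.uθ i| ≤ (σ.Dθ (I + 1) : ℤ) := by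
    intro i hi
    refine (abs_le_of_eq_three_mul_add (Λ.uθ_eq_of_mem v i₁ hi) (hadm.uθ_le i (hsub i hi))
      (hrepr0 _) (hrepr2 _)).trans ?_
    have := hfin.Dθ_succ
    omega
  exact
    { card_le := (Finset.card_le_card (Λ.reindex3_B_subset v i₁)).trans (hadm.card_le.trans hfin.cardB_mono)
      exists_ne := ⟨i₁, hi₁', hp₁⟩
      deg_ne := by
        intro i hi i' hi' hκ hne
        rw [hdeg, hdeg]
        refine hadm.deg_ne i (hsub i hi) i' (hsub i' hi') ?_ hne
        funext k
        have hk := congrFun hκ k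
        unfold allκ at hk ⊢
        rw [Λ.snoc_eq_of_mem v i₁ hi k, Λ.snoc_eq_of_mem v i₁ hi' k]
        change (Fin.snoc (Λ'.u i) (Λ'.uθ i) : Fin (S.d + 1) → ℤ) k =
          (Fin.snoc (Λ'.u i') (Λ'.uθ i') : Fin (S.d + 1) → ℤ) k at hk
        rw [hk]
      R_ne := by
        intro i hi h0
        have hlc := leadingCoeff_comp (p := Λ.R i) (q := C (3⁻¹ : ℚ) * X) (by rw [hq1]; exact one_ne_zero)
        change (Λ.R i).comp (C (3⁻¹ : ℚ) * X) = 0 at h0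
        rw [h0, leadingCoeff_zero, leadingCoeff_C_mul_X] at hlc
        exact (mul_ne_zero (leadingCoeff_ne_zero.mpr (hadm.R_ne i (hsub i hi))) (pow_ne_zero _ (by norm_num)))
          hlc.symm
      deg_le := fun i hi => (hdeg i).le.trans (hadm.deg_le i (hsub i hi))
      p_le := fun i hi => hadm.p_le i (hsub i hi)
      u_le := hu'
      uθ_le := huθ'
      dir_le := fun i hi j =>
        (S.abs_dirScalar_le (hu' i hi) (huθ' i hi) j).trans (hfin.Xb_succ j)
      slab := by
        intro i hi
        -- `δ′(i₁, i) = 3⁻¹·(δ(i₀, i) − δ(i₀, i₁))`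
        have hfun : ∀ i ∈ Λ'.B, Λ.u i = (fun j => 3 * Λ'.u i j + S.repr3 v (Fin.castSucc j)) ∧
            Λ.uθ i = 3 * Λ'.uθ i + S.repr3 v (Fin.last S.d) :=
          fun i hi => ⟨funext fun j => Λ.u_eq_of_mem v i₁ hi j, Λ.uθ_eq_of_mem v i₁ hi⟩
        have hz : ∀ i ∈ Λ'.B, S.zexpo (Λ.u i) (Λ.uθ i) =
            3 * S.zexpo (Λ'.u i) (Λ'.uθ i) +
              S.zexpo (fun j => S.repr3 v (Fin.castSucc j)) (S.repr3 v (Fin.last S.d)) := by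
          intro i hi
          rw [(hfun i hi).1, (hfun i hi).2, S.zexpo_reindex3]
        have e : S.δexpo Λ'.u Λ'.uθ i₁ i =
            (3 : ℚ_[2])⁻¹ * (S.δexpo Λ.u Λ.uθ Λ.i₀ i - S.δexpo Λ.u Λ.uθ Λ.i₀ i₁) := by
          unfold δexpo
          rw [hz i hi, hz i₁ hi₁']
          field_simp
          ring
        change ‖S.δexpo Λ'.u Λ'.uθ i₁ i‖ ≤ _
        rw [e, norm_mul, norm_inv, norm_three_two, inv_one, one_mul, sub_eq_add_neg]
        exact (IsUltrametricDist.norm_add_le_max _ _).trans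
          (max_le (hadm.slab i (hsub i hi)) (by rw [norm_neg]; exact hadm.slab i₁ hi₁))
      wt := by
        intro i hi t₀ k
        change ‖(hw (fun i => (Λ.R i).comp (C (3⁻¹ : ℚ) * X)) i t₀).coeff k‖ * _ ≤ _
        rw [norm_coeff_hw_comp_third]
        exact (hadm.wt i (hsub i hi) t₀ k).trans hfin.Bw_mono
      hasse := fun i hi x τ => hbs.hasse Λ hadm i (hsub i hi) x τ
      shape := hbs.shape Λ hadm v i₁ hi₁' }

/-! ### The third step -/

/-- **THE THIRD STEP OF THE LEVEL INDUCTION**: `ThirdStepTwo σ Sh I` from the record's `ThirdFinalTwo σ I`, the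
assembler's `BasisStepTwo σ Sh I`, and the `3`-Kummer condition on the `d + 1` generators `(α, θ)`.
[cite: Yu2013, Lemmas 5.3–5.4] [cite: Nesterenko2003, §4.3] -/
theorem thirdStepTwo_of {I : ℕ} (hfin : ThirdFinalTwo σ I) (hbs : BasisStepTwo σ Sh I)
    (hK : ∀ κ : Fin (S.d + 1) → ℕ, (∃ j, ¬ 3 ∣ κ j) → ∀ γ : ℚ, ∏ j, S.toQ.all j ^ κ j ≠ γ ^ 3) :
    ThirdStepTwo σ Sh I := by
  intro Λ hadm hvan
  obtain ⟨i₁, hi₁, hp₁⟩ := hadm.exists_ne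
  refine ⟨Λ.reindex3 (S.res3 (Fin.snoc (Λ.u i₁) (Λ.uθ i₁)) 1) i₁, adm_reindex3 σ Sh hfin hbs hadm hi₁ hp₁, ?_⟩
  exact S.vanish_cop_reindex3 Λ (thirdVec_eq_zero_of_adm σ Sh hfin hbs hK hadm hvan) _ i₁

end TwoSetup

end Summit.ABC.StewartYu

end
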